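import Summits.CriticalPhenomena.PercolationContinuityZ3.Theorems.PercNearOneGluingNoHeavyLowerTailSahiCombLower
import Summits.CriticalPhenomena.PercolationContinuityZ3.Theorems.PercNearOneGluingNoHeavyLowerTailSahiCombCylinder

/-!
# The comb (tensor-Bernstein) hierarchy for Sahi's `E_k`, IX: the typed `k → k+1` step at the comb level on ALL FIVE strata, every `k`
# (increasing and decreasing events)

Support file of the one-cut programme (crux `NoHeavyLowerTail`, stmt-CriticalPhenomena-4575; cell `prim-masterthm`, seat P3; HIERARCHY.md §9).
`…SahiCombStrata` proved the comb-level step on four strata for every `k` and the cylinder stratum at order 3; `…SahiCombCylinder` supplies the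
cylinder rung for every `k`.  This file only ASSEMBLES: GIVEN (M⁺-j) for all `j ≤ k + 2`, a family of `k + 3` increasing (resp. decreasing) events
with a comparable pair, OR a cylinder (resp. co-cylinder) member, OR a member independent of the rest, OR a deleted family in `Z_{k+2}`, OR a member
containing the intersection of all the others, has `E_{k+3}` comb-positive at multidegree `k + 3` — the exact comb analogue of p4's law-level
`sahiE_ind_nonneg_of_not_residual` / `sahiE_ind_lower_nonneg_of_not_residual` (`SahiMasterFamilyResidualStep`, `…LowerResidualStep`) with the
total-meet stratum added.  So the comb conjecture (M⁺-(k+3)) reduces to (M⁺-≤k+2) plus its residual class (antichain, pairwise dependent, no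
cylinder, no total-meet member), for every `k`.  HONEST FRAMING: nothing here asserts (M⁺-k) or `C_k` for `k ≥ 3`. [this work]
-/

noncomputable section

open scoped Classical

namespace Summit.CriticalPhenomena.PercolationContinuityZ3.Theorems

open Finset Function
open Literature.Combinatorics.Sahi2008
open Literature.Probability.LatticeModels (isUpperSet_preimage_compl isLowerSet_preimage_compl)
open Literature.Probability.Percolation (DeterminedBy determinedBy_iff)
open Literature.Probability.Percolation.DecisionTree (ind ind_of_mem ind_of_not_mem ind_nonneg)
open SahiComb

variable {ι : Type} [Fintype ι]

/-- **The comb-level `k → k+1` step on all five strata, every `k` (increasing events).**  GIVEN `MasterFamilyCombPos j` for all `j ≤ k + 2`, a family of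
`k + 3` increasing events with (R4) a comparable pair, OR (R5) a cylinder member `{ω | S ⊆ ω}`, OR (R3) a member determined by `F` while the others are
determined by `Fᶜ`, OR (R6) a deleted family in `Z_{k+2}`, OR (R7′) a member containing the intersection of all the others, has `p ↦ E_{k+3}(μ_p; 1_U)`
comb-positive at multidegree `k + 3`. [this work] -/
theorem combPos_sahiE_ind_of_not_residual_five {k : ℕ} (hN : ∀ j, j ≤ k + 2 → MasterFamilyCombPos j)
    (U : Fin (k + 3) → Set (Set ι)) (hU : ∀ j, IsUpperSet (U j))
    (h : (∃ i j : Fin (k + 3), j ≠ i ∧ U j ⊆ U i) ∨ (∃ (m : Fin (k + 3)) (S : Set ι), U m = {ω : Set ι | S ⊆ ω}) ∨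
      (∃ (m : Fin (k + 3)) (F : Finset ι), DeterminedBy (U m) (↑F : Set ι) ∧
        ∀ j, DeterminedBy (U (m.succAbove j)) (↑F : Set ι)ᶜ) ∨
      (∃ m : Fin (k + 3), SuppZeroFlag (k + 2) (fun j => U (m.succAbove j))) ∨
      (∃ m : Fin (k + 3), (⋂ j, U (m.succAbove j)) ⊆ U m)) :
    CombPos (fun _ : ι => k + 3) (fun p => sahiE (bernoulliWeight p) (k + 3) (fun j => ind (U j))) := by
  rcases h with h4 | ⟨m, S, hm⟩ | h3 | h6 | h7
  · exact combPos_sahiE_ind_of_not_residual hN U hU (Or.inl h4)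
  · exact combPos_sahiE_ind_of_cylinder hN U hU m S hm
  · exact combPos_sahiE_ind_of_not_residual hN U hU (Or.inr (Or.inl h3))
  · exact combPos_sahiE_ind_of_not_residual hN U hU (Or.inr (Or.inr (Or.inl h6)))
  · exact combPos_sahiE_ind_of_not_residual hN U hU (Or.inr (Or.inr (Or.inr h7)))

/-- **The comb-level `k → k+1` step on all five strata, every `k` (DECREASING events; co-cylinders `{ω | Disjoint ω S}`).** [this work] -/
theorem combPos_sahiE_ind_lower_of_not_residual_five {k : ℕ} (hN : ∀ j, j ≤ k + 2 → MasterFamilyCombPos j)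
    (D : Fin (k + 3) → Set (Set ι)) (hD : ∀ j, IsLowerSet (D j))
    (h : (∃ i j : Fin (k + 3), j ≠ i ∧ D j ⊆ D i) ∨ (∃ (m : Fin (k + 3)) (S : Set ι), D m = {ω : Set ι | Disjoint ω S}) ∨
      (∃ (m : Fin (k + 3)) (F : Finset ι), DeterminedBy (D m) (↑F : Set ι) ∧
        ∀ j, DeterminedBy (D (m.succAbove j)) (↑F : Set ι)ᶜ) ∨
      (∃ m : Fin (k + 3), SuppZeroFlag (k + 2) (fun j => D (m.succAbove j))) ∨
      (∃ m : Fin (k + 3), (⋂ j, D (m.succAbove j)) ⊆ D m)) :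
    CombPos (fun _ : ι => k + 3) (fun p => sahiE (bernoulliWeight p) (k + 3) (fun j => ind (D j))) := by
  have hU : ∀ j, IsUpperSet (compl ⁻¹' D j) := fun j => isUpperSet_preimage_compl (hD j)
  have hstrata : (∃ i j : Fin (k + 3), j ≠ i ∧ compl ⁻¹' D j ⊆ compl ⁻¹' D i) ∨
      (∃ (m : Fin (k + 3)) (S : Set ι), compl ⁻¹' D m = {ω : Set ι | S ⊆ ω}) ∨
      (∃ (m : Fin (k + 3)) (F : Finset ι), DeterminedBy (compl ⁻¹' D m) (↑F : Set ι) ∧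
        ∀ j, DeterminedBy (compl ⁻¹' D (m.succAbove j)) (↑F : Set ι)ᶜ) ∨
      (∃ m : Fin (k + 3), SuppZeroFlag (k + 2) (fun j => compl ⁻¹' D (m.succAbove j))) ∨
      (∃ m : Fin (k + 3), (⋂ j, compl ⁻¹' D (m.succAbove j)) ⊆ compl ⁻¹' D m) := by
    rcases h with h4 | h5 | h3 | h6 | ⟨m, hmeet⟩
    · rcases strata_preimage_compl (Or.inl h4) with h' | h' | h' | h'
      · exact Or.inl h'
      · exact Or.inr (Or.inl h')
      · exact Or.inr (Or.inr (Or.inl h'))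
      · exact Or.inr (Or.inr (Or.inr (Or.inl h')))
    · rcases strata_preimage_compl (Or.inr (Or.inl h5)) with h' | h' | h' | h'
      · exact Or.inl h'
      · exact Or.inr (Or.inl h')
      · exact Or.inr (Or.inr (Or.inl h'))
      · exact Or.inr (Or.inr (Or.inr (Or.inl h')))
    · rcases strata_preimage_compl (Or.inr (Or.inr (Or.inl h3))) with h' | h' | h' | h'
      · exact Or.inl h'
      · exact Or.inr (Or.inl h')
      · exact Or.inr (Or.inr (Or.inl h'))
      · exact Or.inr (Or.inr (Or.inr (Or.inl h')))
    · rcases strata_preimage_compl (Or.inr (Or.inr (Or.inr h6))) with h' | h' | h' | h'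
      · exact Or.inl h'
      · exact Or.inr (Or.inl h')
      · exact Or.inr (Or.inr (Or.inl h'))
      · exact Or.inr (Or.inr (Or.inr (Or.inl h')))
    · exact Or.inr (Or.inr (Or.inr (Or.inr ⟨m, preimage_compl_totalMeet hmeet⟩)))
  have h1 := (combPos_sahiE_ind_of_not_residual_five hN (fun j => compl ⁻¹' D j) hU hstrata).reflect
  exact h1.congr fun p => sahiE_ind_eq_sahiE_ind_preimage_compl p D

/-- Unconditionally at order 4 GIVEN ONLY (M⁺-3): on the five strata, four increasing events have `E_4` comb-positive at multidegree 4.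
[this work] -/
theorem combPos_sahiE_four_of_not_residual (h3 : MasterFamilyCombPos 3) (U : Fin 4 → Set (Set ι)) (hU : ∀ j, IsUpperSet (U j))
    (h : (∃ i j : Fin 4, j ≠ i ∧ U j ⊆ U i) ∨ (∃ (m : Fin 4) (S : Set ι), U m = {ω : Set ι | S ⊆ ω}) ∨
      (∃ (m : Fin 4) (F : Finset ι), DeterminedBy (U m) (↑F : Set ι) ∧ ∀ j, DeterminedBy (U (m.succAbove j)) (↑F : Set ι)ᶜ) ∨
      (∃ m : Fin 4, SuppZeroFlag 3 (fun j => U (m.succAbove j))) ∨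
      (∃ m : Fin 4, (⋂ j, U (m.succAbove j)) ⊆ U m)) :
    CombPos (fun _ : ι => 4) (fun p => sahiE (bernoulliWeight p) 4 (fun j => ind (U j))) := by
  refine combPos_sahiE_ind_of_not_residual_five (k := 1) (fun j hj => ?_) U hU h
  rcases Nat.lt_or_ge j 3 with hj3 | hj3
  · exact masterFamilyCombPos_of_le_two (by omega)
  · obtain rfl : j = 3 := le_antisymm hj hj3
    exact h3

end Summit.CriticalPhenomena.PercolationContinuityZ3.Theorems
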